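import Literature.AnabelianGeometry.AbsoluteAnabelian.MonoidKummerMapsUnitPairProofs
import Literature.AnabelianGeometry.AbsoluteAnabelian.AbsTopIII.EquivariantSignRigidity
import HarnessLib

/-!
# [AbsTopIII] Prop 3.3 (ii): the `{±1}`-torsor structure of the fibres of
# `Isom((Π ↷ k̄^×),(Π* ↷ k̄*^×)) → Isom(Π, Π*)` (unconditional corollaries)

Proof-only companion (theorems only, no new definitions) of `MonoidKummerMaps.lean` (seat
abc-iut-L4-t2; S. Mochizuki, *Topics in Absolute Anabelian Geometry III*, Prop. 3.3 (ii) p. 74, kurims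
manuscript, lit key `paper:url-5493eb38cbb7`), continuing abc-iut-L6-t21's
`MonoidKummerMapsUnitPairProofs.lean` (determination half, `unitPairIso_isoM_eq`).

`UnitPairIsoFibres` = (determination, `T ∈ {TLG, TCG}`) ∧ (for `TLG`: over every admissible
`f : Π ⥲ Π*` there are EXACTLY TWO isomorphisms of pairs).  Here:

* `GaloisMonoidPair.Iso.tlg_isoM_eq_or_mul_eq_one` — UNCONDITIONAL: two isomorphisms of MLF-Galois
  `TLG`-pairs with the same Galois component either coincide or are mutually inverse
  (`e₁(x) · e₂(x) = 1` for all `x`) — from the model theorem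
  `MLFClosure.nonZeroDivisors_equivariant_eq_id_or_inv` ("a `Gal(k̄/k)`-equivariant multiplicative
  automorphism of `k̄^×` is `x ↦ x^{±1}`", `EquivariantSignRigidity.lean`);
* `GaloisMonoidPair.exists_tlg_inversion`, `GaloisMonoidPair.Iso.tlg_fibre_eq_pair` — UNCONDITIONAL and
  independent of the binders of the named fact: the inversion is an isomorphism of pairs over the
  identity, and the fibre through ANY isomorphism of pairs `e` is exactly `{e, e ∘ inversion}`;
* the REDUCTION of the named fact `UnitPairIsoFibres` to the pure existence of lifts is abc-iut-L6-t21's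
  `MonoidKummerMapsUnitFibresProofs.unitPairIsoFibres_iff_exists_lift` (with
  `unitPairIso_fibre_two_of_exists_lift`), the theorems OF RECORD for that statement; the model
  theorem used below (`MLFClosure.nonZeroDivisors_equivariant_eq_id_or_inv`,
  `EquivariantSignRigidity.lean`) is the same statement as abc-iut-L6-t21's earlier
  `MLFClosure.nonZeroDivisors_mulEquiv_eq_self_or_eq_inv` (`MLFGaloisUnitsRigidityProofs.lean`,
  p409421), proved independently (revision note: v1 of this file, p411006, duplicated the FQN
  `unitPairIsoFibres_iff_exists_lift` of abc-iut-L6-t21's pending p409683 by this seat's error; the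
  duplicate declarations are removed here).

HONEST FRAMING: OUR kernel check of (a reduction of) a statement of a refereed paper; nothing here
bears on [IUTchIII] Cor. 3.12.
-/

noncomputable section

namespace Literature.AnabelianGeometry.AbsoluteAnabelian

open scoped nonZeroDivisors
open _root_.ValuativeRel

/-! ### The model core: isomorphisms out of a pair isomorphic to the `TLG` model pair -/

/-- **Core (model level).**  For the model data `(k, k̄, Π_k ↠ G_k)` and its model `TLG`-pair
`Q₀ = (Π_k ↷ k̄^×)`, any pair `P` isomorphic to `Q₀` (`ι`) and isomorphisms `e₁, e₂ : P ⥲ Q` with the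
same Galois component: `e₁ = e₂` on objects, or `e₁(x) · e₂(x) = 1` for every `x`.  (The composite
`ι ≫ e₁ ≫ e₂⁻¹ ≫ ι⁻¹` is a `Gal(k̄/k)`-equivariant automorphism of `k̄^×`, hence the identity or the
inversion.) [cite: MochizukiAbsTopIII2015, Proposition 3.3 (ii) p.74] -/
theorem GaloisMonoidPair.Iso.isoM_eq_or_mul_eq_one_of_model (C : MLFClosure.{0})
    (D : ModelMLFGaloisData C.k C.K) {Q₀ P Q : GaloisMonoidPair.{0}}
    (hQ₀ : D.monoidPair .TLG = some Q₀) (ι : GaloisMonoidPair.Iso Q₀ P)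
    (e₁ e₂ : GaloisMonoidPair.Iso P Q) (hPi : e₁.isoPi = e₂.isoPi) :
    e₁.isoM = e₂.isoM ∨ ∀ x : P.M, e₁.isoM x * e₂.isoM x = 1 := by
  classical
  simp only [ModelMLFGaloisData.monoidPair, Option.some.injEq] at hQ₀
  subst hQ₀
  letI : MulDistribMulAction D.Pi (C.K)⁰ :=
    D.submonoidAction (nonZeroDivisors C.K) (fun σ _ h => smul_mem_nonZeroDivisors σ h)
  -- the equivariant automorphism `β₀` of the model object `(k̄)⁰` over the identity
  set β₀ : (C.K)⁰ ≃* (C.K)⁰ := ι.isoM.trans (e₁.isoM.trans (e₂.isoM.symm.trans ι.isoM.symm)) with hβ₀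
  have hβ₀_apply : ∀ m, β₀ m = ι.isoM.symm (e₂.isoM.symm (e₁.isoM (ι.isoM m))) := fun m => rfl
  have hβ₀_smul : ∀ (g : D.Pi) (m : (C.K)⁰), β₀ (g • m) = g • β₀ m := by
    intro g m
    rw [hβ₀_apply, hβ₀_apply, ι.smul_comm, e₁.smul_comm, GaloisMonoidPair.Iso.symm_smul_comm,
      GaloisMonoidPair.Iso.symm_smul_comm, hPi, ContinuousMulEquiv.symm_apply_apply,
      ContinuousMulEquiv.symm_apply_apply]
  have hsmul : ∀ (g : D.Pi) (m : (C.K)⁰), ((g • m : (C.K)⁰) : C.K) = D.aug g (m : C.K) :=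
    fun g m => rfl
  have hβσ : ∀ (σ : C.K ≃ₐ[C.k] C.K) (x y : (C.K)⁰), (y : C.K) = σ x →
      ((β₀ y : (C.K)⁰) : C.K) = σ ((β₀ x : (C.K)⁰) : C.K) := by
    intro σ x y hy
    obtain ⟨g, rfl⟩ := D.aug_surjective σ
    have hyx : y = g • x := Subtype.ext (by rw [hy, hsmul])
    rw [hyx, hβ₀_smul, hsmul]
  rcases C.nonZeroDivisors_equivariant_eq_id_or_inv β₀ hβσ with hid | hinv
  · left
    apply MulEquiv.ext
    intro p
    have h1 := hid (ι.isoM.symm p)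
    rw [hβ₀_apply, MulEquiv.apply_symm_apply] at h1
    have h2 := congrArg ι.isoM h1
    rw [MulEquiv.apply_symm_apply, MulEquiv.apply_symm_apply] at h2
    have h3 := congrArg e₂.isoM h2
    rw [MulEquiv.apply_symm_apply] at h3
    exact h3
  · right
    intro p
    set m : (C.K)⁰ := ι.isoM.symm p with hm
    have hp : p = ι.isoM m := by rw [hm, MulEquiv.apply_symm_apply]
    -- `β₀ m * m = 1` in `(k̄)⁰`
    have hβm : β₀ m * m = 1 := Subtype.ext (by
      rw [Submonoid.coe_mul, hinv m, inv_mul_cancel₀ (nonZeroDivisors.coe_ne_zero m)]; rfl)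
    rw [hβ₀_apply] at hβm
    -- transport along `ι` and `e₂`
    have h2 := congrArg ι.isoM hβm
    rw [map_mul, MulEquiv.apply_symm_apply, map_one, ← hp] at h2
    have h3 := congrArg e₂.isoM h2
    rw [map_mul, MulEquiv.apply_symm_apply, map_one] at h3
    -- h3 : e₁.isoM p * e₂.isoM p = 1
    exact h3

/-! ### Prop 3.3 (ii) for `TLG`: the dichotomy, unconditionally -/

/-- **[AbsTopIII] Prop 3.3 (ii), `TLG`, PROVED (torsor half, unconditional form)**: two isomorphisms
of MLF-Galois `TLG`-pairs `(Π ↷ M) ⥲ (Π* ↷ M*)` with the same Galois component `Π ⥲ Π*` either have the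
same object component or are mutually inverse, `e₁(x) · e₂(x) = 1` — "determined … up to the
`{±1}`-orbit" (p. 74).  (Only the hypothesis on `P` is used.)
[cite: MochizukiAbsTopIII2015, Proposition 3.3 (ii) p.74] -/
theorem GaloisMonoidPair.Iso.tlg_isoM_eq_or_mul_eq_one {P Q : GaloisMonoidPair.{0}}
    (hP : IsMLFGaloisMonoidPair .TLG P) (e₁ e₂ : GaloisMonoidPair.Iso P Q)
    (hPi : e₁.isoPi = e₂.isoPi) :
    e₁.isoM = e₂.isoM ∨ ∀ x : P.M, e₁.isoM x * e₂.isoM x = 1 := by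
  obtain ⟨C, D, Q₀, hQ₀, ⟨ι⟩⟩ := hP.exists_model
  exact GaloisMonoidPair.Iso.isoM_eq_or_mul_eq_one_of_model C D hQ₀ ι e₁ e₂ hPi

/-- In an MLF-Galois `TLG`-pair `(Π ↷ M)` (`M ≅ k̄^×`) every element of the object is invertible and
not every element is its own inverse: there is an isomorphism of pairs `(Π ↷ M) ⥲ (Π ↷ M)` over the
identity of `Π` — "the inversion" — which is not the identity, and it multiplies to `1` against the
identity.  (Existence statement, used to populate the fibres.) [cite: MochizukiAbsTopIII2015, Proposition 3.3 (ii) p.74] -/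
theorem GaloisMonoidPair.exists_tlg_inversion {P : GaloisMonoidPair.{0}} (hP : IsMLFGaloisMonoidPair .TLG P) :
    ∃ j : GaloisMonoidPair.Iso P P, j.isoPi = ContinuousMulEquiv.refl P.Pi ∧
      (∀ x : P.M, x * j.isoM x = 1) ∧ j.isoM ≠ MulEquiv.refl P.M := by
  classical
  obtain ⟨C, D, Q₀, hQ₀, ⟨ι⟩⟩ := hP.exists_model
  simp only [ModelMLFGaloisData.monoidPair, Option.some.injEq] at hQ₀
  subst hQ₀
  letI : MulDistribMulAction D.Pi (C.K)⁰ :=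
    D.submonoidAction (nonZeroDivisors C.K) (fun σ _ h => smul_mem_nonZeroDivisors σ h)
  haveI : CharZero C.K := C.charZero_K
  have hne : ∀ x : (C.K)⁰, (x : C.K) ≠ 0 := fun x => nonZeroDivisors.coe_ne_zero x
  have hsmul : ∀ (g : D.Pi) (m : (C.K)⁰), ((g • m : (C.K)⁰) : C.K) = D.aug g (m : C.K) :=
    fun g m => rfl
  -- the inversion of `(k̄)⁰`
  let invK : (C.K)⁰ ≃* (C.K)⁰ :=
    { toFun := fun x => ⟨(x : C.K)⁻¹, mem_nonZeroDivisors_of_ne_zero (inv_ne_zero (hne x))⟩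
      invFun := fun x => ⟨(x : C.K)⁻¹, mem_nonZeroDivisors_of_ne_zero (inv_ne_zero (hne x))⟩
      left_inv := fun x => Subtype.ext (by simp)
      right_inv := fun x => Subtype.ext (by simp)
      map_mul' := fun x y => Subtype.ext (by
        change ((x * y : (C.K)⁰) : C.K)⁻¹ = (x : C.K)⁻¹ * (y : C.K)⁻¹
        rw [Submonoid.coe_mul, mul_inv]) }
  have hinvK : ∀ x : (C.K)⁰, ((invK x : (C.K)⁰) : C.K) = (x : C.K)⁻¹ := fun x => rfl
  have hinvK_smul : ∀ (g : D.Pi) (m : (C.K)⁰), invK (g • m) = g • invK m := by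
    intro g m
    apply Subtype.ext
    rw [hinvK, hsmul, hsmul, hinvK, map_inv₀]
  -- transport to `P`
  let jM : P.M ≃* P.M := ι.isoM.symm.trans (invK.trans ι.isoM)
  have hjM : ∀ x, jM x = ι.isoM (invK (ι.isoM.symm x)) := fun x => rfl
  refine ⟨{ isoPi := ContinuousMulEquiv.refl P.Pi, isoM := jM, smul_comm := ?_ }, rfl, ?_, ?_⟩
  · intro g x
    change jM (g • x) = g • jM x
    rw [hjM, hjM, GaloisMonoidPair.Iso.symm_smul_comm, hinvK_smul, ι.smul_comm,
      ContinuousMulEquiv.apply_symm_apply]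
  · intro x
    change x * jM x = 1
    rw [hjM]
    set m := ι.isoM.symm x with hm
    have hx : x = ι.isoM m := by rw [hm, MulEquiv.apply_symm_apply]
    have hmm : m * invK m = 1 := Subtype.ext (by
      rw [Submonoid.coe_mul, hinvK, mul_inv_cancel₀ (hne m)]; rfl)
    rw [hx, ← map_mul, hmm, map_one]
  · intro h
    -- evaluate at the image of `2 ∈ k̄^×`
    have h2ne : (2 : C.K) ≠ 0 := two_ne_zero
    set two : (C.K)⁰ := ⟨2, mem_nonZeroDivisors_of_ne_zero h2ne⟩ with htwo
    have h' : jM = MulEquiv.refl P.M := h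
    have h1 : jM (ι.isoM two) = ι.isoM two := by rw [h']; rfl
    rw [hjM, MulEquiv.symm_apply_apply] at h1
    have h3 : invK two = two := ι.isoM.injective h1
    have h4 := congrArg Subtype.val h3
    rw [hinvK, htwo] at h4
    -- h4 : (2 : K)⁻¹ = 2
    norm_num at h4

/-! ### The fibres of `Isom((Π ↷ M),(Π* ↷ M*)) → Isom(Π, Π*)` over `TLG` -/

/-- **[AbsTopIII] Prop 3.3 (ii), `TLG`, fibre structure — PROVED (independent of the binders of the
named fact).**  For MLF-Galois `TLG`-pairs, the fibre of `Isom((Π ↷ M),(Π* ↷ M*)) → Isom(Π, Π*)`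
through any given isomorphism of pairs `e` consists of EXACTLY two elements: `e` and `e ∘ (inversion)`
("the `{±1}`-orbit", p. 74).  Existence of SOME `e` over a given `Π ⥲ Π*` (local class field theory)
is not addressed. [cite: MochizukiAbsTopIII2015, Proposition 3.3 (ii) p.74] -/
theorem GaloisMonoidPair.Iso.tlg_fibre_eq_pair {P Q : GaloisMonoidPair.{0}}
    (hP : IsMLFGaloisMonoidPair .TLG P) (e : GaloisMonoidPair.Iso P Q) :
    ∃ e₂ : GaloisMonoidPair.Iso P Q, e₂.isoPi = e.isoPi ∧ e.isoM ≠ e₂.isoM ∧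
      (∀ x : P.M, e.isoM x * e₂.isoM x = 1) ∧
      ∀ e' : GaloisMonoidPair.Iso P Q, e'.isoPi = e.isoPi → (e'.isoM = e.isoM ∨ e'.isoM = e₂.isoM) := by
  classical
  obtain ⟨j, hjPi, hjinv, hjne⟩ := GaloisMonoidPair.exists_tlg_inversion hP
  -- the twisted isomorphism `e ∘ j`
  let e₂ : GaloisMonoidPair.Iso P Q :=
    { isoPi := e.isoPi, isoM := j.isoM.trans e.isoM
      smul_comm := fun g x => by
        change e.isoM (j.isoM (g • x)) = e.isoPi g • e.isoM (j.isoM x)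
        rw [j.smul_comm, hjPi, ContinuousMulEquiv.refl_apply, e.smul_comm] }
  have he₂M : ∀ x, e₂.isoM x = e.isoM (j.isoM x) := fun x => rfl
  have hmul : ∀ x : P.M, e.isoM x * e₂.isoM x = 1 := fun x => by
    rw [he₂M, ← map_mul, hjinv x, map_one]
  refine ⟨e₂, rfl, ?_, hmul, ?_⟩
  · -- `e ≠ e ∘ j` since `j ≠ id`
    intro h
    apply hjne
    apply MulEquiv.ext
    intro x
    have hx := congrArg (fun φ : P.M ≃* Q.M => φ x) h
    simp only [he₂M] at hx
    exact (e.isoM.injective hx).symm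
  · intro e' he'
    rcases GaloisMonoidPair.Iso.tlg_isoM_eq_or_mul_eq_one hP e' e he' with h | h
    · exact Or.inl h
    · right
      apply MulEquiv.ext
      intro x
      -- both `e' x` and `e₂ x = e (j x)` are inverses of `e x` in the commutative monoid `Q.M`
      exact left_inv_eq_right_inv (h x) (hmul x)

end Literature.AnabelianGeometry.AbsoluteAnabelian

end
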